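import Summits.AnomalousDissipation.AnomalousDissipation.Theorems.BaireTransferRobustLoudUpgradeStubLsFoldPeriodicB
import Summits.AnomalousDissipation.AnomalousDissipation.Theorems.BaireTransferRobustLoudUpgradeStubLsFamilyPeriodicPhase
import Literature.Analysis.Calculus.BorderedSecondOrder

/-!
# Stub `stub_lsFoldPeriodic` of the line `malkin-cone-group-orbits` (crux stmt-AnomalousDissipation-1144, companion c3):
# TRANSVERSAL FOLDS OF CYCLES ARE ROBUST CROSSINGS (registered stub, Pi-form)

Assembly.  The free-period lattice map `N̂(x, ω) = (ω∂ₛx + L₀x + B(x,x), φx)` — bordered by the phase functional `φ = Re⟪g,·⟫` of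
`…StubLsFamilyPeriodicPhase` (`φ g = ‖g‖²`, `φ x₀ = 0`), hence QUADRATIC without constant: `N̂ = Â + B̂(·,·)` (`lsFamilyPeriodic_partD`,
`quadratic_form_periodicMap`) — is run through `Calculus.malkin_implicit_family` with the VISIBLE force direction `frc d` as border (range transfer
by `forced_classical`); the cokernel functional `ψ` of `Calculus.exists_cokernel_functional` sees the second-order vector `B̂(ĝ, ĝ)` of the kernel
line (`fold_transfer` + the intrinsic transversality hypothesis), `Dυ(0,1)` spans the kernel line (`lsFoldPeriodic_partA/B`), and
`Calculus.robustCrossing_of_fold` gives the sign change of `σ` at forces `c + s d → c`; zeros of `σ` are realised by `witness_of_latticeSol`.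
Pure proof file; notations verbatim from `PeriodicNSOrbitPersistsProofs`.  Refs: Kielhöfer 2012 §I.12–I.13; Chow–Hale 1982 Ch. 6, 9; Iooss 1972.
-/


-- `Summit.<Summit>.<Problem>` is the tree's mandated summit-side namespace (CONVENTIONS §2); for this
-- single-conjunct summit the two coincide, so the duplicate is deliberate.
set_option linter.dupNamespace false

noncomputable section

open scoped BigOperators Topology ENNReal NNReal ComplexConjugate
open Filter Set Function MeasureTheory UnitAddTorus

namespace Summit.AnomalousDissipation.AnomalousDissipation.Theorems.RobustLoudUpgrade.LsFamilyPeriodic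

open Literature.Analysis.FunctionSpaces Literature.Analysis.FunctionSpaces.Torus
open Literature.Analysis.FunctionSpaces.EuclideanSpace
open Literature.Analysis.FluidPDE
open Literature.Analysis.FluidPDE.ScalarFourier
open Literature.Analysis.FluidPDE.TimePeriodicLattice
open Summit.AnomalousDissipation.AnomalousDissipation.Theses.BaireTransfer

-- NOTATION START (verbatim from `PeriodicNSOrbitPersistsProofs`)
/-- Local notation: the parabolic weight `Λ(n, k) = |n| + |k|²`. -/
local notation:max "Λ" m:max => (|((Prod.fst m : ℤ) : ℝ)| + freqNormSq (Prod.snd m))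

/-- Local notation: the convective symbol on `ℤ × ℤ³` (as in `TimePeriodicNSLattice`). -/
local notation:max "𝐍[" a ", " b "]" m:max =>
  (WithLp.toLp 2 (fun p : Fin 3 => ∑ j : Fin 3, ∑' m' : ℤ × (Fin 3 → ℤ),
    a m' j * (dsym j (Prod.snd m - Prod.snd m') * b (m - m') p)) : EuclideanSpace ℂ (Fin 3))

/-- Local notation: division by the weight. -/
local notation:max "𝐜" x:max => (fun mm : ℤ × (Fin 3 → ℤ) =>
  ((((|((Prod.fst mm : ℤ) : ℝ)| + freqNormSq (Prod.snd mm))⁻¹ : ℝ) : ℂ) • x mm))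

/-- Local notation: multiplication by the weight. -/
local notation:max "𝐬" x:max => (fun mm : ℤ × (Fin 3 → ℤ) =>
  ((((|((Prod.fst mm : ℤ) : ℝ)| + freqNormSq (Prod.snd mm)) : ℝ) : ℂ) • x mm))

/-- Local notation: the family of coefficients of `x ∈ W ⊂ ℓ²`. -/
local notation:max "𝐰" x:max =>
  (((x : lp (fun _ : ℤ × (Fin 3 → ℤ) => EuclideanSpace ℂ (Fin 3)) 2)) : ℤ × (Fin 3 → ℤ) → EuclideanSpace ℂ (Fin 3))

/-- Local notation: the extension `K ↦ c (K₀, tail K)` of a lattice family to `ℤ⁴`. -/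
local notation:max "𝐄" c:max => (fun K : Fin 4 → ℤ => c ((K 0, Fin.tail K) : ℤ × (Fin 3 → ℤ)))

/-- Local notation: the lattice family `û(n,k) = 𝓕(complexify ∘ (U − m₀))(n,k)`. -/
local notation:max "𝐮[" U ", " m₀ "]" => (fun mm : ℤ × (Fin 3 → ℤ) =>
  mFourierCoeff (EuclideanSpace.complexify ∘ fun y : UnitAddTorus (Fin 4) => U y - m₀)
    (Fin.cons (Prod.fst mm) (Prod.snd mm) : Fin 4 → ℤ))

/-- Local notation: the force family `y_F(n,k) = [k ≠ 0][n = 0] 𝓕(complexify ∘ F)(k)`. -/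
local notation:max "𝐲" F:max => (fun mm : ℤ × (Fin 3 → ℤ) =>
  (ite (Prod.snd mm = 0) (0 : EuclideanSpace ℂ (Fin 3))
    (ite (Prod.fst mm = 0) (mFourierCoeff (EuclideanSpace.complexify ∘ F) (Prod.snd mm)) 0)))

/-- Local notation: the lattice family of the orbit `u` with period `τ`. -/
local notation:max "𝐨[" τ ", " u "]" => (fun mm : ℤ × (Fin 3 → ℤ) =>
  mFourierCoeff (EuclideanSpace.complexify ∘ fun y : UnitAddTorus (Fin 4) => Torus.timeRoll τ u y - ∫ x, u 0 x)
    (Fin.cons (Prod.fst mm) (Prod.snd mm) : Fin 4 → ℤ))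
/-- Local notation: the time multiplier `dₛ(n,k) = 2πi n / Λ(n,k)`. -/
local notation "dS" => (fun mm : ℤ × (Fin 3 → ℤ) =>
  (2 * Real.pi * Complex.I * ((Prod.fst mm : ℤ) : ℂ)) * ((((|((Prod.fst mm : ℤ) : ℝ)| + freqNormSq (Prod.snd mm)) : ℝ) : ℂ))⁻¹)

/-- Local notation: the Stokes–drift multiplier `(4π²ν|k|² + 2πi m₀·k) / Λ(n,k)`. -/
local notation "dL[" ν ", " m₀ "]" => (fun mm : ℤ × (Fin 3 → ℤ) =>
  (((4 * Real.pi ^ 2 * ν * freqNormSq (Prod.snd mm) : ℝ) : ℂ) +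
      2 * Real.pi * Complex.I * (∑ jj : Fin 3, ((m₀ jj : ℝ) : ℂ) * (((Prod.snd mm) jj : ℤ) : ℂ))) *
    ((((|((Prod.fst mm : ℤ) : ℝ)| + freqNormSq (Prod.snd mm)) : ℝ) : ℂ))⁻¹)

/-- Local notation: the symbol `σ_om(n,k) = 2πiomn + 4π²ν|k|² + 2πi m₀·k`. -/
local notation "σ[" om ", " ν ", " m₀ "]" => (fun mm : ℤ × (Fin 3 → ℤ) =>
  2 * Real.pi * Complex.I * ((om : ℝ) : ℂ) * ((Prod.fst mm : ℤ) : ℂ) +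
    (((4 * Real.pi ^ 2 * ν * freqNormSq (Prod.snd mm) : ℝ)) : ℂ) +
    2 * Real.pi * Complex.I * (∑ jj : Fin 3, ((m₀ jj : ℝ) : ℂ) * (((Prod.snd mm) jj : ℤ) : ℂ)))
-- NOTATION END

variable {W : Submodule ℝ (lp (fun _ : ℤ × (Fin 3 → ℤ) => EuclideanSpace ℂ (Fin 3)) 2)}

/-! ## The registered stub -/

section Main

set_option maxHeartbeats 3200000 in
/-- **Registered stub `stub_lsFoldPeriodic`** (companion c3): transversal folds of cycles are robust crossings — see the module docstring.
[folklore] -/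
theorem stub_lsFoldPeriodic : ∀ (S : Finset (Fin 3 → ℤ)) (c d : Coeff S) (ν τ : ℝ) (u : ℝ → UnitAddTorus (Fin 3) → EuclideanSpace ℝ (Fin 3)) (p : ℝ → UnitAddTorus (Fin 3) → ℝ) (v : ℝ → UnitAddTorus (Fin 3) → EuclideanSpace ℝ (Fin 3)), 0 < ν → 0 < τ → IsClassicalNSSolutionOn Set.univ ν (fun _ => force S c) u p → Function.Periodic u τ → (∃ t x, Torus.timeDerivWithin Set.univ u t x ≠ 0) → IsSmoothSpaceTimeOn Set.univ v → Function.Periodic v τ → (∀ t, IsDivFree (v t)) → (∀ t, HasZeroMean (v t)) → (¬ ∃ z : ℂ, ∀ t x, Torus.realToComplex (v t x) = z • velocityDot u t x) → (∀ (w : ℝ → UnitAddTorus (Fin 3) → EuclideanSpace ℂ (Fin 3)) (β : ℂ), w ∈ linPeriodicSol ν u τ (fun t x => β • velocityDot u t x) → ∃ z₁ z₂ : ℂ, ∀ t x, w t x = z₁ • velocityDot u t x + z₂ • Torus.realToComplex (v t x)) → (∀ (wr : ℝ → UnitAddTorus (Fin 3) → EuclideanSpace ℝ (Fin 3)) (β'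 : ℝ), IsSmoothSpaceTimeOn Set.univ wr → Function.Periodic wr τ → (fun t x => Torus.realToComplex (wr t x)) ∈ linPeriodicSol ν u τ (fun t x => (β' : ℂ) • velocityDot u t x) → (¬ ∃ z : ℂ, ∀ t x, Torus.realToComplex (wr t x) = z • velocityDot u t x) → ∀ β : ℂ, linPeriodicSol ν u τ (fun t x => β • velocityDot u t x + Torus.realToComplex (Torus.convect (wr t) (wr t) x - β' • Torus.timeDerivWithin Set.univ wr t x)) = ∅) → (∀ β : ℂ, linPeriodicSol ν u τ (fun t x => β • velocityDot u t x + cplx (force S d) x) = ∅) → ∃ σ : Coeff S × ℝ → ℝ, (∀ δ : ℝ, 0 < δ → ∃ r : ℝ, 0 < r ∧ ContinuousOn σ (Metric.ball (c, (0 : ℝ)) r) ∧ ∀ q ∈ Metric.ball (c, (0 : ℝ)) r, σ q = 0 → ∃ (τ' : ℝ) (u' : ℝ → UnitAddTorus (Fin 3) → EuclideanSpace ℝ (Fin 3)) (p' : ℝ → UnitAddTorus (Fin 3) → ℝ), 0 < τ' ∧ IsClassicalNSSolutionOn Set.univ ν (fun _ => force S q.1) u' p' ∧ Function.Periodic u'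 τ' ∧ ∀ t, (∫ x, ‖u' t x - u (τ / τ' * t) x‖ ^ 2) + gradNormSq (fun x => u' t x - u (τ / τ' * t) x) ≤ δ) ∧ ∀ η : ℝ, 0 < η → ∃ (c₁ : Coeff S) (s₁ s₂ : ℝ), dist c₁ c < η ∧ |s₁| < η ∧ |s₂| < η ∧ σ (c₁, s₁) < 0 ∧ 0 < σ (c₁, s₂) := by
  intro S c d ν τ u p v hν hτ hsol hper hmov hsv hperv hvdiv hv0 hdeg hker hfold hvis
  -- §1 the lattice set-up (verbatim `TimePeriodicLattice.persists_main`)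
  obtain ⟨W, hW, hWc⟩ := exists_space
  haveI : CompleteSpace W := completeSpace_W hWc
  have hf : IsSmooth (force S c) := SteadyPersist.isSmooth_force' c
  have hfd : IsDivFree (force S c) := SteadyPersist.isDivFree_force' c
  have hf0 : HasZeroMean (force S c) := SteadyPersist.hasZeroMean_force' c
  have hU : IsSmooth (timeRoll τ u) := orbit_isSmooth hsol hper
  have hu0 : ∀ n : ℤ, 𝐨[τ, u] ((n, 0) : ℤ × (Fin 3 → ℤ)) = 0 := orbit_zero_modes hsol hper hf0
  have hut := orbit_transversal hsol hper
  have huc := orbit_conj hsol hper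
  have hur := orbit_rapidDecay hsol hper
  have hmomx₀ : ∀ N : ℕ, ∑' m : ℤ × (Fin 3 → ℤ), ENNReal.ofReal ((Λ m) ^ N) * ‖(𝐬 (𝐨[τ, u])) m‖ₑ ^ 2 ≠ ⊤ := fun N =>
    moments_of_rapidDecay (C := mFourierCoeff (complexify ∘ fun y => timeRoll τ u y - ∫ x, u 0 x)) hur N
  have hx₀2 : ∑' m : ℤ × (Fin 3 → ℤ), ‖(𝐬 (𝐨[τ, u])) m‖ₑ ^ 2 ≠ ⊤ := by
    have := hmomx₀ 0; simpa only [pow_zero, ENNReal.ofReal_one, one_mul] using this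
  obtain ⟨x₀, hx₀⟩ := exists_memW hW (v := 𝐬 (𝐨[τ, u])) hx₀2 (sw_zero_mode (x := 𝐨[τ, u]) hu0)
    (sw_transversal (x := 𝐨[τ, u]) hut) (sw_neg (x := 𝐨[τ, u]) huc)
  have hcx₀ : 𝐜 (𝐰 x₀) = 𝐨[τ, u] := by rw [hx₀]; exact cw_sw (x := 𝐨[τ, u]) hu0
  have hg2 : ∑' m : ℤ × (Fin 3 → ℤ),
      ‖(fun mm : ℤ × (Fin 3 → ℤ) => (2 * Real.pi * Complex.I * (mm.1 : ℂ)) • (𝐬 (𝐨[τ, u])) mm) m‖ₑ ^ 2 ≠ ⊤ := by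
    have h1 := tsum_enorm_nsmul_sq_le (𝐬 (𝐨[τ, u])) 0
    simp only [pow_zero, ENNReal.ofReal_one, one_mul, zero_add] at h1
    exact ne_top_of_le_ne_top (ENNReal.mul_ne_top ENNReal.ofReal_ne_top (hmomx₀ 2)) h1
  obtain ⟨g, hg⟩ := exists_memW hW (v := fun mm : ℤ × (Fin 3 → ℤ) => (2 * Real.pi * Complex.I * (mm.1 : ℂ)) • (𝐬 (𝐨[τ, u])) mm)
    hg2 (nsmul_zero_mode (x := 𝐬 (𝐨[τ, u])) (sw_zero_mode (x := 𝐨[τ, u]) hu0))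
    (nsmul_transversal (x := 𝐬 (𝐨[τ, u])) (sw_transversal (x := 𝐨[τ, u]) hut))
    (nsmul_neg (x := 𝐬 (𝐨[τ, u])) (sw_neg (x := 𝐨[τ, u]) huc))
  obtain ⟨Ds, hDs, -⟩ := exists_diag hW (d := dS) (M := 2 * Real.pi) norm_dS_le dS_neg
  obtain ⟨L₀, hL₀, -⟩ := exists_diag hW (d := dL[ν, ∫ x, u 0 x]) norm_dL_le dL_neg
  obtain ⟨c₁, hc₁, hcl₁⟩ := exists_symbol_lower_bound (inv_pos.2 hτ) hν (∫ x, u 0 x)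
  obtain ⟨J, hJ1, -, -, -⟩ := exists_diagEquiv hW (d := fun mm => ((τ⁻¹ : ℝ) : ℂ) * dS mm + dL[ν, ∫ x, u 0 x] mm)
    (norm_omega_dS_add_dL_le τ⁻¹) (omega_dS_add_dL_neg τ⁻¹) hc₁ (le_norm_omega_dS_add_dL hcl₁)
  have hJ : ∀ h : W, J h = τ⁻¹ • Ds h + L₀ h := fun h => W_ext fun m => by
    rw [hJ1, coeW_add, coeW_smul, Pi.add_apply, Pi.smul_apply, hDs, hL₀, ← Complex.coe_smul, smul_smul, ← add_smul]
  obtain ⟨B, hBf, hBb⟩ := exists_bilinear hW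
  obtain ⟨K, hK'⟩ : ∃ K : W →L[ℝ] W, ∀ w, K w = B x₀ w + B w x₀ :=
    ⟨(hBb.deriv (x₀, x₀)).comp ((ContinuousLinearMap.id ℝ W).prod (ContinuousLinearMap.id ℝ W)), fun w => by
      simp [IsBoundedBilinearMap.deriv_apply]⟩
  have hx₀w : ∑' m : ℤ × (Fin 3 → ℤ), ENNReal.ofReal ((1 + Λ m) * sobolevWeight 1 m.2) * ‖(𝐜 (𝐰 x₀)) m‖ₑ ≠ ⊤ := by
    rw [hcx₀]; exact tsum_wt_weight_enorm_ne_top_of_rapidDecay hur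
  have hKc : IsCompactOperator K := isCompactOperator_linearised hW hWc hBf x₀ hx₀w K hK'
  -- §2 the force map and the state vector of `v`; the base-point equation
  obtain ⟨Fm, hFm⟩ := exists_forceMapST hW S
  obtain ⟨kv, hkv⟩ := exists_fieldVecW hW hsv hperv hvdiv hv0
  have hy0 : τ⁻¹ • Ds x₀ + L₀ x₀ + B x₀ x₀ = Fm c := by
    refine W_ext fun m => ?_
    by_cases hm : m.2 = 0
    · rw [W_zero' hW _ hm, W_zero' hW _ hm]
    · rw [coord_G hDs hL₀ hBf x₀ τ⁻¹ m, hFm, hcx₀, yf_of_snd_ne_zero (force S c) hm]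
      exact orbit_equation hsol hper hτ hfd m hm
  -- §3 `g ≠ 0`, `∂ₛx₀ ≠ 0`; the phase functional `Re⟪g,·⟫`
  have hfam0 : ¬ ∀ m : ℤ × (Fin 3 → ℤ), (2 * Real.pi * Complex.I * (m.1 : ℂ)) • 𝐨[τ, u] m = 0 := by
    intro hall
    have hfam : ∀ m : ℤ × (Fin 3 → ℤ), (1 : ℂ) • ((2 * Real.pi * Complex.I * (m.1 : ℂ)) • 𝐨[τ, u] m) +
        (0 : ℂ) • 𝐮[timeRoll τ v, 0] m = 0 := fun m => by rw [hall m, smul_zero, zero_smul, add_zero]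
    exact one_ne_zero (eq_zero_of_lincomb_family_eq_zero (u := u) (v := v) hτ hsol.smooth_velocity hper hsv hperv
      (∫ x, u 0 x) hmov hdeg hfam).1
  have hsmul_zero_iff : ∀ m : ℤ × (Fin 3 → ℤ), (2 * Real.pi * Complex.I * (m.1 : ℂ)) • (𝐬 (𝐨[τ, u])) m = 0 →
      (2 * Real.pi * Complex.I * (m.1 : ℂ)) • 𝐨[τ, u] m = 0 := by
    intro m hm0
    by_cases hm : m.2 = 0
    · have h0 : 𝐨[τ, u] m = 0 := by
        have := hu0 m.1; rwa [show ((m.1, 0) : ℤ × (Fin 3 → ℤ)) = m from Prod.ext rfl hm.symm] at this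
      rw [h0, smul_zero]
    · have hL : ((((Λ m)) : ℝ) : ℂ) ≠ 0 := by exact_mod_cast ne_of_gt (lt_of_lt_of_le one_pos (one_le_wt hm))
      simp only [smul_smul] at hm0
      rw [mul_comm, ← smul_smul, smul_eq_zero] at hm0
      rcases hm0 with h1 | h1
      · exact absurd h1 hL
      · exact h1
  have hg0 : g ≠ 0 := by
    intro hg0
    refine hfam0 fun m => hsmul_zero_iff m ?_
    have h1 := congrArg (fun z : W => (𝐰 z) m) hg0
    simp only at h1
    rw [hg, coeW_zero, Pi.zero_apply] at h1
    exact h1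
  have hDs0 : Ds x₀ ≠ 0 := by
    intro hD0
    refine hfam0 fun m => ?_
    have h1 := congrArg (fun z : W => (𝐰 z) m) hD0
    simp only at h1
    have h2 := coe_smul_Ds_orbit hDs hsol hper hf0 x₀ hx₀ 1 m
    rw [one_smul, h1, coeW_zero, Pi.zero_apply, Complex.ofReal_one, one_smul] at h2
    exact h2.symm
  have hgx : ∀ m : ℤ × (Fin 3 → ℤ), (𝐰 g) m = (2 * Real.pi * Complex.I * (m.1 : ℂ)) • (𝐰 x₀) m := fun m => by rw [hg, hx₀]
  obtain ⟨φ, hφg, hφx₀, -⟩ := exists_phaseFunctional g x₀ hgx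
  have hφ : φ g ≠ 0 := by rw [hφg]; exact pow_ne_zero 2 (norm_ne_zero_iff.2 hg0)
  -- §4 the bordered free-period map: linearisation, compactness, quadratic structure
  set T : W →L[ℝ] W := (J : W →L[ℝ] W) + K with hT
  have hTx : ∀ h, T h = J h + K h := fun h => rfl
  obtain ⟨G', hG', hG'x⟩ := exists_hasStrictFDerivAt_periodicMap Ds L₀ hBb x₀ τ⁻¹
  set Th : (W × ℝ) →L[ℝ] (W × ℝ) := G'.prod (φ.comp (ContinuousLinearMap.fst ℝ W ℝ)) with hTh
  have hThx : ∀ q : W × ℝ, Th q = (T q.1 + q.2 • Ds x₀, φ q.1) := by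
    rintro ⟨h, μ⟩
    refine Prod.ext ?_ ?_
    · simp only [hTh, ContinuousLinearMap.prod_apply, hG'x, hTx, hJ, hK']
      abel
    · simp [hTh]
  set Jh : (W × ℝ) ≃L[ℝ] (W × ℝ) := J.prodCongr (ContinuousLinearEquiv.refl ℝ ℝ) with hJh
  have hThe : Th = (((T.comp (ContinuousLinearMap.fst ℝ W ℝ) + (ContinuousLinearMap.snd ℝ W ℝ).smulRight (Ds x₀)).prod
      (φ.comp (ContinuousLinearMap.fst ℝ W ℝ)))) := by
    refine ContinuousLinearMap.ext fun q => ?_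
    rw [hThx]
    obtain ⟨h, μ⟩ := q
    simp
  have hcomp : IsCompactOperator ((Th - (Jh : (W × ℝ) →L[ℝ] (W × ℝ)) : (W × ℝ) →L[ℝ] (W × ℝ))) := by
    rw [hThe, hJh, hT]
    exact lsFamilyPeriodic_partC W J K (Ds x₀) φ hKc
  obtain ⟨Bh, hBh⟩ := lsFamilyPeriodic_partD W Ds B hBb
  set Ah : (W × ℝ) →L[ℝ] (W × ℝ) := (L₀.comp (ContinuousLinearMap.fst ℝ W ℝ)).prod (φ.comp (ContinuousLinearMap.fst ℝ W ℝ)) with hAh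
  set Nh : W × ℝ → W × ℝ := fun q => (q.2 • Ds q.1 + L₀ q.1 + B q.1 q.1, φ q.1) with hNh
  have hNq : ∀ q : W × ℝ, Nh q = Ah q + Bh q q := fun q => quadratic_form_periodicMap Ds L₀ B φ Bh hBh q
  have hThA : ∀ w : W × ℝ, Th w = Ah w + Bh (x₀, τ⁻¹) w + Bh w (x₀, τ⁻¹) := by
    rintro ⟨h, μ⟩
    rw [hThx, hBh, hBh]
    simp only [hAh, ContinuousLinearMap.prod_apply, ContinuousLinearMap.comp_apply, ContinuousLinearMap.coe_fst', Prod.mk_add_mk,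
      add_zero, hTx, hJ, hK']
    refine Prod.ext ?_ rfl
    simp only
    abel
  set frc : Coeff S →L[ℝ] (W × ℝ) := (-Fm).prod (0 : Coeff S →L[ℝ] ℝ) with hfrc
  have hfrcx : ∀ d' : Coeff S, frc d' = (-(Fm d'), 0) := fun d' => by simp [hfrc]
  have h0 : Nh (x₀, τ⁻¹) + frc c = 0 := by
    rw [hfrcx]
    simp only [hNh, Prod.mk_add_mk, add_zero, hy0, add_neg_cancel, hφx₀, Prod.mk_zero_zero]
  have h0' : Ah (x₀, τ⁻¹) + Bh (x₀, τ⁻¹) (x₀, τ⁻¹) + frc c = 0 := by rw [← hNq]; exact h0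
  have hNd : HasFDerivAt Nh Th (x₀, τ⁻¹) := by
    have h2 : HasFDerivAt (fun q : W × ℝ => φ q.1) (φ.comp (ContinuousLinearMap.fst ℝ W ℝ)) (x₀, τ⁻¹) :=
      φ.hasFDerivAt.comp (x₀, τ⁻¹) hasFDerivAt_fst
    exact hG'.hasFDerivAt.prodMk h2
  have hNc : ContDiffAt ℝ 1 Nh (x₀, τ⁻¹) := by
    have h1 : ContDiff ℝ 1 (fun q : W × ℝ => q.2 • Ds q.1) := by
      have ha : ContDiff ℝ 1 (fun q : W × ℝ => q.2) := contDiff_snd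
      have hb : ContDiff ℝ 1 (fun q : W × ℝ => Ds q.1) := Ds.contDiff.comp contDiff_fst
      exact ha.smul hb
    have h2 : ContDiff ℝ 1 (fun q : W × ℝ => L₀ q.1) := L₀.contDiff.comp contDiff_fst
    have h3 : ContDiff ℝ 1 (fun q : W × ℝ => B q.1 q.1) :=
      (hBb.contDiff.comp ((contDiff_fst (E := W) (F := ℝ)).prodMk (contDiff_fst (E := W) (F := ℝ))) :)
    have h4 : ContDiff ℝ 1 (fun q : W × ℝ => φ q.1) := φ.contDiff.comp contDiff_fst
    exact (((h1.add h2).add h3).prodMk h4).contDiffAt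
  -- §5 the visible border `frc d` is not in the range; the kernel is a line
  have hrange : ∀ q : W × ℝ, Th q ≠ frc d := by
    rintro ⟨h, μ⟩ hq
    rw [hThx, hfrcx] at hq
    have hq1 : T h + μ • Ds x₀ = -(Fm d) := congrArg Prod.fst hq
    have hFmD : 𝐰 (Fm d) = 𝐮[timeRoll τ (fun _ : ℝ => force S d), 0] := by
      rw [hFm]; exact yf_eq_constField τ (SteadyPersist.isSmooth_force' d) (SteadyPersist.hasZeroMean_force' d)
    have heqW : τ⁻¹ • Ds (-h) + L₀ (-h) + (B x₀ (-h) + B (-h) x₀) = (-(-μ)) • Ds x₀ + Fm d := by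
      have e1 : T (-h) = -(T h) := map_neg T h
      rw [← hJ (-h), ← hK' (-h), ← hTx, e1, neg_neg, eq_neg_of_add_eq_zero_left (show T h + (μ • Ds x₀ + Fm d) = 0 by
        rw [← add_assoc, hq1, neg_add_cancel])]
      abel
    obtain ⟨w, hw⟩ := forced_classical hW hDs hL₀ hBf hν hτ hsol hper hf0 x₀ hx₀ (H := fun _ : ℝ => force S d)
      (isSmoothSpaceTimeOn_const (SteadyPersist.isSmooth_force' d) univ) (fun t => rfl)
      (fun _ => SteadyPersist.isDivFree_force' d) (fun _ => SteadyPersist.hasZeroMean_force' d) (Fm d) hFmD (-h) (-μ) heqW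
    have := hvis ((((-(-μ) : ℝ)) : ℂ) * (τ : ℂ))
    rw [Set.eq_empty_iff_forall_notMem] at this
    exact this w hw
  have hninj : ¬ Function.Injective Th := fun hi =>
    hrange _ (Classical.choose_spec ((Literature.Analysis.Calculus.bijective_of_injective_of_isCompactOperator Th Jh hcomp hi).2 (frc d)))
  obtain ⟨gh, hghT, hgh0⟩ : ∃ q : W × ℝ, Th q = 0 ∧ q ≠ 0 := by
    by_contra hcon
    push Not at hcon
    exact hninj ((injective_iff_map_eq_zero Th).2 hcon)
  have hdec : ∀ (h : W) (μ : ℝ), T h + μ • Ds x₀ = 0 → ∃ a b : ℝ, h = a • g + b • kv := by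
    intro h μ hq
    have heqW : τ⁻¹ • Ds h + L₀ h + (B x₀ h + B h x₀) = (-μ) • Ds x₀ := by
      rw [← hJ h, ← hK' h, ← hTx, neg_smul, eq_neg_iff_add_eq_zero, hq]
    exact ker_decomp hW hDs hL₀ hBf hν hτ hsol hper hf0 hmov hsv hperv hvdiv hv0 hdeg hker x₀ hx₀ g hg kv hkv h μ heqW
  have hghT1 : T gh.1 + gh.2 • Ds x₀ = 0 := by
    have := congrArg Prod.fst (hThx gh); rw [hghT] at this; exact this.symm
  have hφgh : φ gh.1 = 0 := by have := congrArg Prod.snd (hThx gh); rw [hghT] at this; exact this.symm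
  have hker' : ∀ q : W × ℝ, Th q = 0 → ∃ z : ℝ, q = z • gh := by
    intro q hq
    have hq1 : T q.1 + q.2 • Ds x₀ = 0 := by have := congrArg Prod.fst (hThx q); rw [hq] at this; exact this.symm
    have hq2 : φ q.1 = 0 := by have := congrArg Prod.snd (hThx q); rw [hq] at this; exact this.symm
    exact lsFamilyPeriodic_partB W (T : W →ₗ[ℝ] W) (φ : W →ₗ[ℝ] ℝ) (Ds x₀) g kv gh hDs0 hφ
      (fun h μ hh => hdec h μ hh) hghT1 hφgh hgh0 q hq1 hq2
  obtain ⟨φ₂, -, hφ₂g⟩ := exists_dual_vector ℝ gh (norm_ne_zero_iff.2 hgh0)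
  have hφ₂ : φ₂ gh ≠ 0 := by rw [hφ₂g]; exact_mod_cast norm_ne_zero_iff.2 hgh0
  -- §6 the Malkin implicit family with the visible border
  obtain ⟨σ, υ, ℓ, r, hr, -, hυ0, hσℓ, -, hυd, hℓ01, -, hσc, hυc, hsolq, -⟩ :=
    Literature.Analysis.Calculus.malkin_implicit_family Nh frc Th Jh φ₂ (x₀, τ⁻¹) gh c (frc d) hNc hNd h0 hcomp hker' hrange hφ₂
  refine ⟨σ, fun δ hδ => ?_, fun η hη => ?_⟩
  · -- §7 zeros of `σ` are periodic orbits of the uncorrected forces, uniformly close to `u`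
    obtain ⟨ε, hε⟩ : ∃ ε : ℝ, ε = Real.sqrt (δ / (3 * (1 + 4 * Real.pi ^ 2))) := ⟨_, rfl⟩
    have hε0 : 0 < ε := by rw [hε]; exact Real.sqrt_pos.2 (by positivity)
    have hε2 : 3 * (1 + 4 * Real.pi ^ 2) * ε ^ 2 = δ := by rw [hε, Real.sq_sqrt (by positivity)]; field_simp
    obtain ⟨δ₁, hδ₁⟩ : ∃ δ₁ : ℝ, δ₁ = min (τ⁻¹ / 2) ε := ⟨_, rfl⟩
    have hδ₁0 : 0 < δ₁ := by rw [hδ₁]; exact lt_min (by positivity) hε0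
    have hδ₁τ : δ₁ ≤ τ⁻¹ / 2 := by rw [hδ₁]; exact min_le_left _ _
    have hδ₁ε : δ₁ ≤ ε := by rw [hδ₁]; exact min_le_right _ _
    have hball : Metric.ball ((c, (0 : ℝ)) : Coeff S × ℝ) r ∈ 𝓝 ((c, (0 : ℝ)) : Coeff S × ℝ) :=
      Metric.isOpen_ball.mem_nhds (Metric.mem_ball_self hr)
    have hυa : ContinuousAt υ (c, 0) := (hυc (c, 0) (Metric.mem_ball_self hr)).continuousAt hball
    obtain ⟨r₁, hr₁, hυr₁⟩ := Metric.continuousAt_iff.1 hυa δ₁ hδ₁0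
    refine ⟨min r r₁, lt_min hr hr₁, hσc.mono (Metric.ball_subset_ball (min_le_left _ _)), fun q hq hσq => ?_⟩
    have hqr : q ∈ Metric.ball ((c, (0 : ℝ)) : Coeff S × ℝ) r := Metric.ball_subset_ball (min_le_left _ _) hq
    have hq₁ : dist q (c, 0) < r₁ := lt_of_lt_of_le (Metric.mem_ball.1 hq) (min_le_right _ _)
    have hυq := hυr₁ hq₁
    rw [hυ0] at hυq
    obtain ⟨hNq', -⟩ := hsolq q hqr
    rw [hσq, zero_smul, sub_zero, hfrcx] at hNq'
    rcases hxq : υ q with ⟨x, om⟩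
    rw [hxq] at hNq' hυq
    have hGx : om • Ds x + L₀ x + B x x = Fm q.1 := by
      have h1 := congrArg Prod.fst hNq'
      simp only [hNh, Prod.mk_add_mk, Prod.fst_zero] at h1
      rw [← sub_eq_zero, ← h1]
      abel
    have hdx : ‖x - x₀‖ < δ₁ := by
      have h1 : dist x x₀ ≤ dist (x, om) (x₀, τ⁻¹) := by rw [Prod.dist_eq]; exact le_max_left _ _
      rw [dist_eq_norm] at h1
      exact lt_of_le_of_lt h1 hυq
    have hdom : |om - τ⁻¹| < δ₁ := by
      have h1 : dist om τ⁻¹ ≤ dist (x, om) (x₀, τ⁻¹) := by rw [Prod.dist_eq]; exact le_max_right _ _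
      rw [Real.dist_eq] at h1
      exact lt_of_le_of_lt h1 hυq
    have hom : 0 < om := by
      have h1 := (abs_lt.1 hdom).1
      have h3 : 0 < τ⁻¹ := inv_pos.2 hτ
      linarith only [h1, h3, hδ₁τ]
    obtain ⟨p', hsol', hper', hclose⟩ := witness_of_latticeSol hW hDs hL₀ hBf hν hsol hper hf0 x₀ hx₀ x hom
      (SteadyPersist.isSmooth_force' q.1) (SteadyPersist.isDivFree_force' q.1) (SteadyPersist.hasZeroMean_force' q.1)
      (Fm q.1) (hFm q.1) hGx
    refine ⟨om⁻¹, _, p', inv_pos.2 hom, hsol', hper', fun t => ?_⟩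
    have hxx : ‖x - x₀‖ ^ 2 ≤ ε ^ 2 := by
      have := hdx.le.trans hδ₁ε
      exact pow_le_pow_left₀ (norm_nonneg _) this 2
    calc _ ≤ (3 * (1 + 4 * Real.pi ^ 2)) * ‖x - x₀‖ ^ 2 := hclose t
      _ ≤ (3 * (1 + 4 * Real.pi ^ 2)) * ε ^ 2 := by gcongr
      _ = δ := hε2
  · -- §8 the fold: `σ` changes sign in the kernel coordinate at forces `c + s d → c`
    have hD : Function.Bijective fun q : (W × ℝ) × ℝ => (Th q.1 - q.2 • frc d, φ₂ q.1) :=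
      Literature.Analysis.Calculus.bordered_bijective Th Jh hcomp gh (frc d) φ₂ hker' hrange hφ₂
    obtain ⟨ψ, hψT, hψe, hψker⟩ := Literature.Analysis.Calculus.exists_cokernel_functional Th φ₂ (frc d) hD hrange
    obtain ⟨Dυ, hDυ⟩ : ∃ D : Coeff S × ℝ →L[ℝ] (W × ℝ), D = fderiv ℝ υ (c, 0) := ⟨_, rfl⟩
    have hυd' : HasFDerivAt υ Dυ (c, 0) := by rw [hDυ]; exact (hυd.differentiableAt (by norm_num)).hasFDerivAt
    obtain ⟨hT01, hφ01⟩ := lsFoldPeriodic_partA (W × ℝ) (W × ℝ) (Coeff S) Nh Th frc (frc d) φ₂ σ υ ℓ Dυ (x₀, τ⁻¹) c r hNd hυ0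
      hσℓ hυd' hr hsolq
    rw [hℓ01, zero_smul] at hT01
    obtain ⟨z, hz⟩ := hker' _ hT01
    have hz0 : z ≠ 0 := by
      intro hz0
      rw [hz0, zero_smul] at hz
      rw [hz, map_zero] at hφ01
      exact one_ne_zero hφ01.symm
    -- the second-order vector of the kernel line is not in the range
    have hkeq : τ⁻¹ • Ds gh.1 + L₀ gh.1 + (B x₀ gh.1 + B gh.1 x₀) = (-gh.2) • Ds x₀ := by
      rw [← hJ gh.1, ← hK' gh.1, ← hTx, neg_smul, eq_neg_iff_add_eq_zero, hghT1]
    obtain ⟨hhr₁, -, -, -, -, -, -⟩ := kernelField hW hDs hL₀ hBf hν hτ hsol hper hf0 x₀ hx₀ gh.1 gh.2 hkeq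
    have hkn : ¬ ∃ z' : ℂ, ∀ t x, fourierSynth (𝐄 (𝐜 (𝐰 gh.1))) (Fin.cons (((τ⁻¹ * t : ℝ)) : UnitAddCircle) x) =
        z' • Torus.realToComplex (Torus.timeDerivWithin univ u t x) := by
      rintro ⟨z', hz'⟩
      have hg1 : gh.1 = 0 := kernel_not_phase hW hτ hsol.smooth_velocity hper g hg hg0 φ hφ gh.1 hhr₁ hφgh hz'
      have hg2' : gh.2 = 0 := by
        have h1 := hghT1; rw [hg1, map_zero, zero_add] at h1
        rcases smul_eq_zero.1 h1 with h2 | h2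
        · exact h2
        · exact absurd h2 hDs0
      exact hgh0 (Prod.ext hg1 hg2')
    have hBgh : ∀ q : W × ℝ, Th q ≠ Bh gh gh := by
      rintro ⟨h, μ⟩ hq
      rw [hThx, hBh] at hq
      have hq1 : T h + μ • Ds x₀ = gh.2 • Ds gh.1 + B gh.1 gh.1 := congrArg Prod.fst hq
      have heqW : τ⁻¹ • Ds h + L₀ h + (B x₀ h + B h x₀) = (-μ) • Ds x₀ + (gh.2 • Ds gh.1 + B gh.1 gh.1) := by
        rw [← hJ h, ← hK' h, ← hTx, ← hq1, neg_smul]; abel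
      exact fold_transfer hW hDs hL₀ hBf hν hτ hsol hper hf0 x₀ hx₀ hfold gh.1 gh.2 hkeq hkn h μ heqW
    have hψgh : ψ (Bh gh gh) ≠ 0 := fun h0ψ => by
      obtain ⟨w, hw⟩ := hψker _ h0ψ
      exact hBgh w hw
    have ha : ψ (Bh (Dυ (0, 1)) (Dυ (0, 1))) ≠ 0 := by
      rw [hz]
      exact lsFoldPeriodic_partB (W × ℝ) (W × ℝ) Bh ψ gh z hz0 hψgh
    have hb : ψ (frc d) ≠ 0 := by rw [hψe]; exact one_ne_zero
    have hsol' : ∀ q ∈ Metric.ball ((c, 0) : Coeff S × ℝ) r, Ah (υ q) + Bh (υ q) (υ q) + frc q.1 - σ q • frc d = 0 := by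
      intro q hq
      rw [← hNq]
      exact (hsolq q hq).1
    obtain ⟨s, x₁, x₂, hdist, hx₁, hx₂, -, -, hσ₁, hσ₂⟩ := Literature.Analysis.Calculus.robustCrossing_of_fold Ah Bh Th frc
      (x₀, τ⁻¹) c d (frc d) ψ σ υ Dυ r hThA hψT hψe h0' hr hυ0 hυd' hσc hsol' ha hb η hη
    exact ⟨c + s • d, x₁, x₂, hdist, hx₁, hx₂, hσ₁, hσ₂⟩

end Main

end Summit.AnomalousDissipation.AnomalousDissipation.Theorems.RobustLoudUpgrade.LsFamilyPeriodic

end
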